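import Literature.NumberTheory.Automorphic.AdelicGLnGlue
import Literature.NumberTheory.Automorphic.RealMatrixGroupsProofs
import Mathlib.Analysis.Normed.Ring.Lemmas
import HarnessLib

/-!
# `K_∞ = ∏_{w real} O(n) × ∏_{w complex} U(n)` is compact — discharge of `isCompact_Kinf`

Topic `NumberTheory/Automorphic`; sibling proof file of `AdelicGLnGlue`, discharging its named fact

* `isCompact_Kinf n K` : the standard maximal compact subgroup `Kinf n K = GL_n(K_∞) ∩ U(n, K_∞)`
  of the archimedean group `GL_n(K_∞)`, `K_∞ = K ⊗_ℚ ℝ = mixedSpace K = ℝ^{r₁} × ℂ^{r₂}`, is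
  compact (Borel–Jacquet, Corvallis (1979), §1.1; Knapp, *Lie Groups Beyond an Introduction*
  (2002), I.§17, (1.135)–(1.137): `O(n)` and `U(n)` are compact),

as `isCompact_Kinf_holds`. This is exactly the interim proof preserved in `AdelicGLnGlue`
(`(archGroupGL n K).isCompact_maximalCompact (isStarFormallyReal_mixedSpace K)`), now fed by the
discharge `RealMatrixGroup.isCompact_maximalCompact_holds` of `RealMatrixGroupsProofs` (Heine–Borel
in `M_n(A)` for a finite-dimensional star-formally-real commutative real `*`-algebra `A`) and the
proved lemma `isStarFormallyReal_mixedSpace` of `AdelicGLnGlue`. Compactness of `K_∞` is one of the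
two compactness inputs of the standard maximal compact subgroup `K = K_∞ · GL_n(𝒪̂_K)` of
`GL_n(𝔸_K)` used by Siegel sets and reduction theory (`ReductionTheoryGLn`,
`standardMaximalCompactGL`; the other, `isCompact_glIntegralLevel`, is discharged in
`GLnAdelicStructureProofs`).

## Design notes

* As in `AdelicGLnGlue` (its note H5), `open scoped Classical` is needed to see the Mathlib
  instances on `mixedSpace K = ({w // IsReal w} → ℝ) × ({w // IsComplex w} → ℂ)` (the `Fintype`
  instances on the two index subtypes want decidability of `IsReal`/`IsComplex`); the normed
  commutative ring structure on the finite products is Mathlib's `Pi.normedCommutativeRing`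
  (`Mathlib.Analysis.Normed.Ring.Lemmas`, imported here) and `Prod.normedCommRing`.
* Nothing in `AdelicGLnGlue` is restated; consumers holding `(h : isCompact_Kinf n K)` are fed
  `isCompact_Kinf_holds n K`.

## References

* A. Borel, H. Jacquet, *Automorphic forms and automorphic representations*, Proc. Sympos. Pure
  Math. 33 (Corvallis 1979), Part 1, §1.1 [BorelJacquet1979].
* A. W. Knapp, *Lie Groups Beyond an Introduction*, 2nd ed. (2002), I.§17, (1.135)–(1.137)
  [Knapp2002].
-/

noncomputable section

open scoped Classical
open NumberField NumberField.mixedEmbedding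

namespace Literature.NumberTheory.Automorphic

variable (n : ℕ) (K : Type) [Field K] [NumberField K]

/-- **`K_∞` is compact** (discharge of `isCompact_Kinf`): `Kinf n K = GL_n(K_∞) ∩ U(n, K_∞)` is
compact, `K_∞ = mixedSpace K = ℝ^{r₁} × ℂ^{r₂}` being a finite-dimensional star-formally-real
commutative real `*`-algebra (`isStarFormallyReal_mixedSpace`), so that
`RealMatrixGroup.isCompact_maximalCompact_holds` applies (Borel–Jacquet (1979), §1.1; Knapp (2002),
I.§17, (1.135)–(1.137): compactness of `O(n)`, `U(n)`). [cite: BorelJacquet1979, §1.1] -/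
theorem isCompact_Kinf_holds : isCompact_Kinf n K :=
  RealMatrixGroup.isCompact_maximalCompact_holds (archGroupGL n K) (isStarFormallyReal_mixedSpace K)

end Literature.NumberTheory.Automorphic
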